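import Literature.Analysis.FluidPDE.PalasekObukhovParams

/-!
# Palasek 2026, §2 and §4: the shell dictionary and the two notions of "embedding"

S. Palasek, *Finite-time blow-up in an elementary model of the 3D Navier–Stokes equations*,
arXiv:2605.13827 (2026) [Palasek2026ElementaryModel], §2 (pp. 7–8, "Motivating the shell model") and
§4 (p. 12, "Prospects for transfer to the PDE setting"). Neither section contains a theorem: §2 is a
DICTIONARY between the model (l2_obukhov) and frequency-localised pieces of a Navier–Stokes field, §4
a DISCUSSION of the open "Step 2" (embedding the model into the true equations). This file types,
statements-first and with nothing asserted, exactly the mathematical content that is printed: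

* §2 (X_Y_relation)/(linfty_obukhov): the `L^∞`-based amplitudes `Y_k` (`X_k = N_k^{-(α-1)}Y_k`,
  "the component localized near the `k`th frequency scale occupies a volume `∼ N_k^{-2(α-1)}`") and the
  `L^∞`-based Obukhov model, with the PROVED identity that it is (l2_obukhov) with a rescaled force
  (`obukhovRHS_ofLinfty`); the vorticity-scale unknown `x_k = N_k^αX_k = N_kY_k` of §3; the blow-up
  profile in the three dictionaries (`X_k = N_k^{β-α}`, `Y_k = N_k^{β-1}`, `x_k = A_k = N_k^β`).
* §2 (energy identity): the exact finite-mode energy balance of (l2_obukhov) — the Obukhov pair of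
  interactions is energy-neutral up to the flux `N_M^α X_M X_{M+1}²` into the first omitted mode
  (`sum_mul_obukhovRHS`, `hasDerivWithinAt_halfSumSq`); the printed identity (2.6) for the infinite
  system "above a certain Onsager-like regularity" is the vanishing of that flux and is not formalised.
* §2/§4 (why super-lacunarity is compatible with the Obukhov pair but not with the Katz–Pavlović
  low-low→high interaction): at the level of Fourier supports of trigonometric polynomials on `𝕋³`
  (bookkept in the group algebra `ℂ[ℤ³]`, whose product is the convolution of coefficients): modes of a
  product lie in the sumset, so two factors with modes in `B(0,R)` cannot force a mode outside `B(0,2R)`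
  (`norm_le_of_mem_support_mul`), whereas a single shell `{±ξ}` forces the zero mode
  (`zero_mem_support_antipodal_sq`) — "`(u_{k+1}⊗u_{k+1})^` can occupy all of `B(0, O(N_{k+1}))`".
* §4 (the two notions of embedding, p. 12): `IsPreciseEmbedding` — "some map that precisely takes
  solutions of the ODE system to solutions of the PDE" [Tao] (with the §2 identification of `X_k` with
  the shell readout, without which the notion is empty) — and `IsRelaxedEmbedding` — "only particular
  solutions of a dyadic model are realized by some appropriate projection of the PDE solutions, up to
  various controlled errors" [Coiculescu–Palasek] — over an ABSTRACT phase space `S`, solution class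
  and shell readout `read k : S → ℝ` (the source fixes none of them); a precise embedding restricts to
  a relaxed one with zero error (`IsPreciseEmbedding.toRelaxed`).

WHAT THIS IS NOT. Step 2 itself — the existence of any embedding of the blow-up solution into forced
or unforced Navier–Stokes — is OPEN ("a plausible candidate", §4) and is NOT stated here as a fact;
in this tree it is the Summits-side conjecture `PalasekStep2` / the route `PalasekTowerBreakdown`.
Nothing in this file is a statement about Navier–Stokes. All declarations are definitions with bodies
or proved lemmas; no named facts.
-/

open Set Filter Finset
open scoped Pointwise

noncomputable section

namespace Literature.Analysis.FluidPDE

namespace PalasekObukhov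

/-! ### §2: the `L^∞` dictionary -/

section Dictionary

variable {ν α : ℝ} {N : ℕ → ℝ}

/-- **(X_Y_relation)**: the `L²`-based amplitude of a shell from its `L^∞`-based one,
`X_k = N_k^{-(α-1)} Y_k` ("`X_k ∼ ‖P_ku‖_{L²}`, `Y_k ∼ ‖P_ku‖_{L^∞}`", the piece at scale `N_k`
occupying a volume `∼ N_k^{-2(α-1)}`). [cite: Palasek2026ElementaryModel, §2 (X_Y_relation)] -/
def ofLinfty (α : ℝ) (N : ℕ → ℝ) (Y : ℕ → ℝ) (k : ℕ) : ℝ :=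
  N k ^ (-(α - 1)) * Y k

/-- The volume fraction `N_k^{-2(α-1)}` occupied by the level-`k` component under the intermittency
assumption of §2 (`α ∈ [1, 5/2]` "corresponding to the 3D Navier–Stokes equations").
[cite: Palasek2026ElementaryModel, §2 ("occupies a volume ∼ N_k^{-2(α-1)}")] -/
def levelVolume (α : ℝ) (N : ℕ → ℝ) (k : ℕ) : ℝ :=
  N k ^ (-(2 * (α - 1)))

/-- `X_k = |vol_k|^{1/2} Y_k`: the `L²` amplitude is the `L^∞` amplitude times the square root of the
occupied volume. [cite: Palasek2026ElementaryModel, §2 (X_Y_relation)] -/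
theorem ofLinfty_eq_sqrt_levelVolume_mul (hN : ∀ j, 0 < N j) (α : ℝ) (Y : ℕ → ℝ) (k : ℕ) :
    ofLinfty α N Y k = Real.sqrt (levelVolume α N k) * Y k := by
  rw [ofLinfty, levelVolume, Real.sqrt_eq_rpow, ← Real.rpow_mul (hN k).le]
  congr 2
  ring

/-- **The `L^∞`-based Obukhov model (linfty_obukhov)** at mode `k` with force value `hk`:
`Y_k' = -νN_k²Y_k + N_{k-1}Y_{k-1}Y_k - (N_k/N_{k+1})^{2(α-1)} N_k Y_{k+1}² + h_k` (`Y_{-1} ≡ 0`).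
[cite: Palasek2026ElementaryModel, §2 (linfty_obukhov)] -/
def linftyRHS (ν α : ℝ) (N : ℕ → ℝ) (Y : ℕ → ℝ) (hk : ℝ) (k : ℕ) : ℝ :=
  -ν * N k ^ 2 * Y k + (if k = 0 then 0 else N (k - 1) * Y (k - 1) * Y k) -
    (N k / N (k + 1)) ^ (2 * (α - 1)) * N k * Y (k + 1) ^ 2 + hk

/-- **"(linfty_obukhov) is equivalent to the `L²`-based Obukhov model (l2_obukhov) with an
appropriately scaled force"**: under `X_j = N_j^{-(α-1)}Y_j` and `f_k = N_k^{-(α-1)}h_k` the right-hand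
side of (l2_obukhov) is `N_k^{-(α-1)}` times that of (linfty_obukhov).
[cite: Palasek2026ElementaryModel, §2 (after (linfty_obukhov))] -/
theorem obukhovRHS_ofLinfty (hN : ∀ j, 0 < N j) (ν α : ℝ) (Y : ℕ → ℝ) (hk : ℝ) (k : ℕ) :
    obukhovRHS ν α N (ofLinfty α N Y) (N k ^ (-(α - 1)) * hk) k =
      N k ^ (-(α - 1)) * linftyRHS ν α N Y hk k := by
  have hk0 := hN k
  have hk1 := hN (k + 1)
  -- `N_k^α = N_k^{-(α-1)} · N_k^{2(α-1)} · N_k`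
  have e1 : N k ^ (-(α - 1)) * N k ^ (2 * (α - 1)) * N k = N k ^ α := by
    rw [← Real.rpow_add hk0, ← Real.rpow_add_one hk0.ne']
    congr 1
    ring
  -- `(N_{k+1}^{-(α-1)})² = (N_{k+1}^{2(α-1)})⁻¹`
  have e2 : (N (k + 1) ^ (-(α - 1))) ^ 2 = (N (k + 1) ^ (2 * (α - 1)))⁻¹ := by
    rw [← Real.rpow_natCast, ← Real.rpow_mul hk1.le, ← Real.rpow_neg hk1.le]
    congr 1
    push_cast
    ring
  have e3 : (N k / N (k + 1)) ^ (2 * (α - 1)) = N k ^ (2 * (α - 1)) / N (k + 1) ^ (2 * (α - 1)) :=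
    Real.div_rpow hk0.le hk1.le _
  have hpow : N (k + 1) ^ (2 * (α - 1)) ≠ 0 := (Real.rpow_pos_of_pos hk1 _).ne'
  rcases Nat.eq_zero_or_pos k with rfl | hkpos
  · simp only [obukhovRHS, linftyRHS, ofLinfty, ↓reduceIte]
    rw [mul_pow, e2, e3, ← e1]
    field_simp
    ring
  · -- `N_{k-1}^α · N_{k-1}^{-(α-1)} = N_{k-1}`
    have e4 : N (k - 1) ^ α * N (k - 1) ^ (-(α - 1)) = N (k - 1) := by
      rw [← Real.rpow_add (hN (k - 1))]
      have : α + -(α - 1) = 1 := by ring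
      rw [this, Real.rpow_one]
    have hk' : k ≠ 0 := Nat.pos_iff_ne_zero.1 hkpos
    simp only [obukhovRHS, linftyRHS, ofLinfty, hk', ↓reduceIte]
    rw [mul_pow, e2, e3, ← e1]
    have e5 : N (k - 1) ^ α * (N (k - 1) ^ (-(α - 1)) * Y (k - 1)) = N (k - 1) * Y (k - 1) := by
      rw [← mul_assoc, e4]
    rw [e5]
    field_simp

/-- **The vorticity-scale unknown of §3**: `x_k = N_k^α X_k = N_k Y_k` ("dimensionally, `x`
corresponds to (for instance) `‖P_kω‖_∞`"). [cite: Palasek2026ElementaryModel, §3 (X_rescaling)] -/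
theorem rpow_mul_ofLinfty (hN : ∀ j, 0 < N j) (α : ℝ) (Y : ℕ → ℝ) (k : ℕ) :
    N k ^ α * ofLinfty α N Y k = N k * Y k := by
  rw [ofLinfty, ← mul_assoc, ← Real.rpow_add (hN k)]
  have : α + -(α - 1) = 1 := by ring
  rw [this, Real.rpow_one]

/-- **The blow-up profile in the velocity dictionary**: at `X_k = N_k^{β-α}` (Rem. 1.7, "the solution
approaches the blow-up state `X_k = N_k^{β-α}`") the `L^∞` amplitude is `Y_k = N_k^{α-1}X_k = N_k^{β-1}`.
[cite: Palasek2026ElementaryModel, §1.2 Rem. 1.7 and §2 (X_Y_relation)] -/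
theorem profile_velocityScale {N₀ : ℝ} (hN₀ : 0 < N₀) (b α β : ℝ) (k : ℕ) :
    scale N₀ b k ^ (α - 1) * scale N₀ b k ^ (β - α) = scale N₀ b k ^ (β - 1) := by
  rw [← Real.rpow_add (scale_pos hN₀ b k)]
  congr 1
  ring

/-- **The blow-up profile in the vorticity dictionary**: at `X_k = N_k^{β-α}` the rescaled unknown is
`x_k = N_k^αX_k = N_k^β = A_k`, the terminal datum of the tower of §3.
[cite: Palasek2026ElementaryModel, §1.2 Rem. 1.7 and §3.1 ("A_k = N_k^β")] -/
theorem profile_vorticityScale {N₀ : ℝ} (hN₀ : 0 < N₀) (b α β : ℝ) (k : ℕ) :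
    scale N₀ b k ^ α * scale N₀ b k ^ (β - α) = amp N₀ b β k := by
  rw [amp, ← Real.rpow_add (scale_pos hN₀ b k)]
  congr 1
  ring

end Dictionary

/-! ### §2: the finite-mode energy balance of (l2_obukhov) -/

section Energy

variable {ν α : ℝ} {N : ℕ → ℝ}

/-- **The Obukhov pair conserves energy up to the flux into the first omitted mode**: for any state
`X` and force values `f`, `Σ_{k≤M} X_k·RHS_k = Σ_{k≤M}(-νN_k²X_k² + X_kf_k) - N_M^αX_MX_{M+1}²`
("the energy transferred up by the first term is balanced by energy transferred down by the second
term"). [cite: Palasek2026ElementaryModel, §2 (energy identity) and footnote to the choice of interactions] -/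
theorem sum_mul_obukhovRHS (ν α : ℝ) (N X f : ℕ → ℝ) (M : ℕ) :
    ∑ k ∈ range (M + 1), X k * obukhovRHS ν α N X (f k) k =
      ∑ k ∈ range (M + 1), (-(ν * N k ^ 2 * X k ^ 2) + X k * f k) - N M ^ α * X M * X (M + 1) ^ 2 := by
  induction M with
  | zero =>
    rw [sum_range_one, sum_range_one, obukhovRHS_zero]
    ring
  | succ M ih =>
    rw [sum_range_succ, ih, obukhovRHS_succ,
      sum_range_succ (fun k => -(ν * N k ^ 2 * X k ^ 2) + X k * f k) (M + 1)]
    ring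

/-- Hence for a state supported on the modes `k ≤ M` (`X_{M+1} = 0`) the nonlinearity is exactly
energy-neutral: `Σ_{k≤M} X_k·RHS_k = Σ_{k≤M}(-νN_k²X_k² + X_kf_k)`. [cite: Palasek2026ElementaryModel, §2 (energy identity)] -/
theorem sum_mul_obukhovRHS_of_truncated (ν α : ℝ) (N X f : ℕ → ℝ) {M : ℕ} (hX : X (M + 1) = 0) :
    ∑ k ∈ range (M + 1), X k * obukhovRHS ν α N X (f k) k =
      ∑ k ∈ range (M + 1), (-(ν * N k ^ 2 * X k ^ 2) + X k * f k) := by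
  rw [sum_mul_obukhovRHS, hX]
  ring

/-- **The energy balance along a solution, finitely many modes**: if the modes `k ≤ M` of `X` obey
(l2_obukhov) at `t` (within `s`), then `e_M = ½Σ_{k≤M}X_k²` has derivative
`Σ_{k≤M}(-νN_k²X_k² + X_kf_k) - N_M^αX_MX_{M+1}²` there — the printed identity
`e(t) + ∫₀ᵗΣνN_k²X_k² = e(0) + ∫₀ᵗΣX_kf_k` for the full system is the statement that the flux term
disappears in the limit `M → ∞` ("for solutions above a certain Onsager-like regularity").
[cite: Palasek2026ElementaryModel, §2 (energy identity)] -/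
theorem hasDerivWithinAt_halfSumSq {X : ℕ → ℝ → ℝ} {f : ℕ → ℝ → ℝ} {s : Set ℝ} {t : ℝ} {M : ℕ}
    (hode : ∀ k ≤ M,
      HasDerivWithinAt (X k) (obukhovRHS ν α N (fun j => X j t) (f k t) k) s t) :
    HasDerivWithinAt (fun r => ∑ k ∈ range (M + 1), 1 / 2 * X k r ^ 2)
      (∑ k ∈ range (M + 1), (-(ν * N k ^ 2 * X k t ^ 2) + X k t * f k t)
        - N M ^ α * X M t * X (M + 1) t ^ 2) s t := by
  have hsum : HasDerivWithinAt (fun r => ∑ k ∈ range (M + 1), 1 / 2 * X k r ^ 2)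
      (∑ k ∈ range (M + 1),
        1 / 2 * (2 * X k t * obukhovRHS ν α N (fun j => X j t) (f k t) k)) s t := by
    refine HasDerivWithinAt.fun_sum fun k hk => ?_
    have hk' : k ≤ M := Nat.lt_succ_iff.1 (mem_range.1 hk)
    have h2 : HasDerivWithinAt (fun r => X k r ^ 2)
        (2 * X k t * obukhovRHS ν α N (fun j => X j t) (f k t) k) s t := by
      simpa using (hode k hk').fun_pow 2
    exact h2.const_mul _
  have heq : ∑ k ∈ range (M + 1), 1 / 2 * (2 * X k t * obukhovRHS ν α N (fun j => X j t) (f k t) k) =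
      ∑ k ∈ range (M + 1), (fun j => X j t) k * obukhovRHS ν α N (fun j => X j t) ((fun j => f j t) k) k := by
    refine sum_congr rfl fun k _ => ?_
    ring
  rw [heq, sum_mul_obukhovRHS] at hsum
  exact hsum

end Energy

/-! ### §2/§4: frequency supports of products (lacunarity and the two nearest-neighbour pairs) -/

section Lacunarity

/-- **Low-low interactions cannot reach far separated shells.** Frequency bookkeeping of
trigonometric polynomials on `𝕋³` in the group algebra `ℂ[ℤ³]` (product = convolution of Fourier
coefficients): if the modes of `a` lie in `B(0, R₁)` and those of `b` in `B(0, R₂)` then every mode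
of the product `a·b` lies in `B(0, R₁ + R₂)`. Hence a quadratic interaction of the level-`(k-1)`
piece with itself (`P_k div u_{k-1}⊗u_{k-1}`, the Katz–Pavlović pair used in [Tao 2016]) forces
nothing at frequencies beyond `2N_{k-1}`: "the frequencies in [MR3486169] cannot be significantly more
separated than `N_k ∼ 2^k`". [cite: Palasek2026ElementaryModel, §4 p. 12 (first advantage); §2 p. 7] -/
theorem norm_le_of_mem_support_mul {R₁ R₂ : ℝ} (a b : AddMonoidAlgebra ℂ (Fin 3 → ℤ))
    (ha : ∀ ξ ∈ a.coeff.support, ‖ξ‖ ≤ R₁) (hb : ∀ ξ ∈ b.coeff.support, ‖ξ‖ ≤ R₂)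
    {ξ : Fin 3 → ℤ} (hξ : ξ ∈ (a * b).coeff.support) : ‖ξ‖ ≤ R₁ + R₂ := by
  classical
  have hmem := AddMonoidAlgebra.support_coeff_mul_subset a b hξ
  obtain ⟨η, hη, ζ, hζ, rfl⟩ := Finset.mem_add.1 hmem
  exact (norm_add_le η ζ).trans (add_le_add (ha η hη) (hb ζ hζ))

/-- **High-high interactions reach the lowest modes, whatever the separation.** The antipodal pair
of modes `±ξ` (a single real Fourier shell, however far out) has the zero mode in the support of
its square: "if `û_{k+1}` is supported in `{|ξ| ∼ N_{k+1}}`, then `(u_{k+1}⊗u_{k+1})^` can occupy all of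
`B(0, O(N_{k+1}))`" — the Obukhov high-high→low interaction `P_k div(u_{k+1}⊗u_{k+1})` acts across any
gap `N_k ≪ N_{k+1}`. [cite: Palasek2026ElementaryModel, §2 p. 7; §4 p. 12 (second advantage)] -/
theorem zero_mem_support_antipodal_sq (ξ : Fin 3 → ℤ) (hξ : ξ ≠ 0) :
    (0 : Fin 3 → ℤ) ∈
      ((AddMonoidAlgebra.single ξ (1 : ℂ) + AddMonoidAlgebra.single (-ξ) 1) *
        (AddMonoidAlgebra.single ξ (1 : ℂ) + AddMonoidAlgebra.single (-ξ) 1)).coeff.support := by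
  classical
  have h2ξ : ξ + ξ ≠ 0 := by
    intro h
    apply hξ
    have : (2 : ℤ) • ξ = 0 := by rwa [two_zsmul]
    exact (smul_eq_zero.1 this).resolve_left (by norm_num)
  have hn2ξ : -ξ + -ξ ≠ 0 := by
    intro h
    apply h2ξ
    have : -(ξ + ξ) = 0 := by rwa [neg_add]
    exact neg_eq_zero.1 this
  rw [Finsupp.mem_support_iff, add_mul, mul_add, mul_add, AddMonoidAlgebra.single_mul_single,
    AddMonoidAlgebra.single_mul_single, AddMonoidAlgebra.single_mul_single,
    AddMonoidAlgebra.single_mul_single, AddMonoidAlgebra.coeff_add, AddMonoidAlgebra.coeff_add,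
    AddMonoidAlgebra.coeff_add, AddMonoidAlgebra.coeff_single, AddMonoidAlgebra.coeff_single,
    AddMonoidAlgebra.coeff_single, AddMonoidAlgebra.coeff_single]
  simp only [Finsupp.add_apply, Finsupp.single_apply, add_neg_cancel, neg_add_cancel, h2ξ, hn2ξ,
    if_true, if_false]
  norm_num

end Lacunarity

/-! ### §4: the two notions of embedding -/

section Embedding

variable {S : Type*}

/-- **Precise embedding** (§4, first notion, after Tao): "some map that precisely takes solutions of
the ODE system to solutions of the PDE". Typed over an abstract phase space `S` of the PDE, a
solution class `odeSol` of the dyadic model (amplitudes `X k t`), a solution class `pdeSol` of PDE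
trajectories `ℝ → S`, and the shell readouts `read k : S → ℝ` of §2 (`‖P_k·‖_{L²}` or `‖P_k·‖_{L^∞}`):
the map `Φ` sends model solutions to PDE solutions AND, on the time set `I`, the readouts of `Φ X`
are the model amplitudes (the §2 identification `X_k ∼ ‖P_ku‖`; without it the constant map would
qualify). The source fixes none of `S`, `pdeSol`, `read`, `I`; they are parameters. [cite: Palasek2026ElementaryModel, §4 p. 12 ("precise notion of embedding")] -/
structure IsPreciseEmbedding (odeSol : (ℕ → ℝ → ℝ) → Prop) (pdeSol : (ℝ → S) → Prop)
    (read : ℕ → S → ℝ) (I : Set ℝ) (Φ : (ℕ → ℝ → ℝ) → ℝ → S) : Prop where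
  /-- solutions go to solutions -/
  maps : ∀ X, odeSol X → pdeSol (Φ X)
  /-- on the time set `I` the shell readouts of the image are the model amplitudes -/
  exact : ∀ X, odeSol X → ∀ k, ∀ t ∈ I, read k (Φ X t) = |X k t|

/-- **Relaxed embedding** (§4, second notion, after Coiculescu–Palasek [MR5008166]): "only particular
solutions of a dyadic model are realized by some appropriate projection of the PDE solutions, up to
various controlled errors" — ONE model trajectory `X`, ONE PDE solution `u`, and on the time set `I`
the readouts match the amplitudes up to the error budget `ε k t` (what "controlled" must mean is left
to the user: e.g. a RELATIVE control `ε ≤ θ|X|` with `θ < 1` is what lets unboundedness of the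
model in a weighted norm pass to the readouts, since then `read_k ≥ (1-θ)|X_k|`).
[cite: Palasek2026ElementaryModel, §4 p. 12 ("more relaxed notion")] -/
structure IsRelaxedEmbedding (pdeSol : (ℝ → S) → Prop) (read : ℕ → S → ℝ) (I : Set ℝ)
    (X : ℕ → ℝ → ℝ) (u : ℝ → S) (ε : ℕ → ℝ → ℝ) : Prop where
  /-- `u` is a PDE solution -/
  solves : pdeSol u
  /-- the readouts realise the amplitudes up to `ε` on `I` -/
  approx : ∀ k, ∀ t ∈ I, |read k (u t) - (|X k t|)| ≤ ε k t

/-- A precise embedding realises every model solution with zero error on its time set.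
[cite: Palasek2026ElementaryModel, §4 p. 12] -/
theorem IsPreciseEmbedding.toRelaxed {odeSol : (ℕ → ℝ → ℝ) → Prop} {pdeSol : (ℝ → S) → Prop}
    {read : ℕ → S → ℝ} {I : Set ℝ} {Φ : (ℕ → ℝ → ℝ) → ℝ → S}
    (h : IsPreciseEmbedding odeSol pdeSol read I Φ) {X : ℕ → ℝ → ℝ} (hX : odeSol X) :
    IsRelaxedEmbedding pdeSol read I X (Φ X) (fun _ _ => 0) where
  solves := h.maps X hX
  approx k t ht := by rw [h.exact X hX k t ht, sub_self, abs_zero]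

end Embedding

end PalasekObukhov

end Literature.Analysis.FluidPDE

end
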